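import Summits.CriticalPhenomena.Ising3DConformalLimit.Theses.MirrorHoelderCompactness
import Literature.Probability.LatticeModels.CriticalAxisRatioRegularity
import HarnessLib

/-!
# Item 6150 `TwoPointDoubling` is LITERALLY the open estimate of the literature — crux `ExistsScaleCovariantLimit`
(item stmt-CriticalPhenomena-1981), funnel level, lead c10

Route `HyperoctahedralRP` (sub-problem `CriticalPhenomena/Ising3DConformalLimit`). The funnel file of lead c9
(`…FunnelThroughDoubling`, p131624) shows that the crux, items 6153/14454/5955/4658 and both live engines (PL₂, BM₂) each
imply item 6150 `MirrorHoelderCompactness.TwoPointDoubling` (`∃ κ > 0, ∀ n ≥ 1, κ g(n) ≤ g(2n)`,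
`g(n) = ⟨σ₀σ_{ne₀}⟩_{β_c(3)}`). This file pins item 6150 to the statements under which it is discussed in print, using only
the tree's axis log-convexity (`criticalTwoPoint_axis_ratio_mono`: `r_k = g(k+1)/g(k)` is nondecreasing, ADC21 Prop. 5.3 /
§5.5) and `g ≤ 1`, `g > 0` (no definition or notation is introduced):

* `twoPointDoubling_iff_axisGradientRate`: **6150 ⟺ the LOG-FREE axial gradient bound**
  `∃ A, ∀ k ≥ 1, g(k) − g(k+1) ≤ A·g(k)/k` — exactly the estimate Aizenman–Duminil-Copin 2021 name as wanted and open
  (Remark 5.10: "It would be of interest to remove the `log n` factor, as this would enable a proof that `S(ne₁)` does not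
  drop too fast between different scales"; their Prop. 5.9 has `C log(n)/n` in place of `A/n`);
* `twoPointDoubling_iff_axisRatioRate`: ⟺ `∃ A, ∀ k ≥ 1, k·(1 − g(k+1)/g(k)) ≤ A` (the rate form of
  `criticalTwoPoint_axis_ratio_tendsto_one`, whose docstring records exactly this rate as the open part);
* `twoPointDoubling_iff_dyadic`: ⟺ doubling along the dyadic scales only, `∃ κ > 0, ∀ j, κ g(2^j) ≤ g(2^{j+1})`;
* `twoPointDoubling_iff_eventually`: ⟺ `∃ κ > 0, ∀ᶠ n, κ g(n) ≤ g(2n)` (i.e. `liminf g(2n)/g(n) > 0`; small `n` are free).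

The real-variable core is proved for an ARBITRARY positive sequence `G` with nondecreasing shifted ratios
`k ↦ G(k+2)/G(k+1)` (Part A: `LogConvexSeq.*`) — which is all reflection positivity gives — and then read on
`G n = criticalTwoPoint 3 (Pi.single 0 n)` (Part B).

Mechanism. (⇒) doubling at `n = ⌈k/2⌉` is a product of `n` ratios `r_m`, `m ≤ k`, each `≤ r_k` by monotonicity, so
`κ ≤ r_kⁿ`, `r_k ≥ κ^{1/n} ≥ 1 + (log κ)/n`, `1 − r_k ≤ 2|log κ|/k`. (⇐) `g(2n)/g(n) = ∏_{m=n}^{2n-1} r_m ≥ r_nⁿ ≥ (1 − A/n)ⁿ ≥ e^{-2A}`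
for `n ≥ 2A` (`log(1−x) ≥ −2x` on `[0,1/2]`), and `≥ r_1ⁿ` for the finitely many smaller `n`.

References: M. Aizenman, H. Duminil-Copin, Ann. of Math. 194 (2021) = arXiv:1912.07973, Prop. 5.3, Prop. 5.9, Remark 5.10 (p. 20)
[AizenmanDuminilCopinAnnals2021]; B. Simon, CMP 77 (1980) Thm. 1 [Simon1980] (positivity via `criticalTwoPoint_bounds_holds`).
-/

noncomputable section

namespace Summit.CriticalPhenomena.Ising3DConformalLimit.Cruxes.ExistsScaleCovariantLimit.Funnel

open Literature.Probability.LatticeModels Filter Real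
open Summit.CriticalPhenomena.Ising3DConformalLimit.Theses

/-! ## Part A. Positive sequences with nondecreasing ratios (`G > 0`, `k ↦ G(k+2)/G(k+1)` monotone) -/

namespace LogConvexSeq

variable {G : ℕ → ℝ}

/-- Upper iteration: for `j ≤ n` and `2n ≤ k + 2`, `G(n+j) ≤ (G(k+2)/G(k+1))^j G(n)` (each of the `j` ratios
`G(m+1)/G(m)`, `n ≤ m ≤ n+j−1 ≤ k+1`, is at most the last one by monotonicity). [folklore] -/
theorem add_le_pow_mul (hpos : ∀ n, 0 < G n) (hmono : Monotone fun k => G (k + 2) / G (k + 1)) {n k : ℕ}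
    (hk : 2 * n ≤ k + 2) : ∀ j : ℕ, j ≤ n → G (n + j) ≤ (G (k + 2) / G (k + 1)) ^ j * G n := by
  intro j
  induction j with
  | zero => intro _; simp
  | succ j ih =>
    intro hj
    have hj' : j ≤ n := Nat.le_of_succ_le hj
    have hrec : G (n + (j + 1)) = G (n + j - 1 + 2) / G (n + j - 1 + 1) * G (n + j) := by
      rw [show n + (j + 1) = (n + j - 1) + 2 by omega, show n + j - 1 + 1 = n + j by omega]
      exact (div_mul_cancel₀ _ (hpos (n + j)).ne').symm
    have hRle : G (n + j - 1 + 2) / G (n + j - 1 + 1) ≤ G (k + 2) / G (k + 1) := hmono (by omega)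
    have hRpos : 0 < G (n + j - 1 + 2) / G (n + j - 1 + 1) := div_pos (hpos _) (hpos _)
    rw [hrec, pow_succ]
    calc G (n + j - 1 + 2) / G (n + j - 1 + 1) * G (n + j)
        ≤ G (k + 2) / G (k + 1) * ((G (k + 2) / G (k + 1)) ^ j * G n) :=
          mul_le_mul hRle (ih hj') (hpos _).le (hRpos.le.trans hRle)
      _ = (G (k + 2) / G (k + 1)) ^ j * (G (k + 2) / G (k + 1)) * G n := by ring

/-- Lower iteration: for `1 ≤ n` and every `j`, `(G(n+1)/G(n))^j G(n) ≤ G(n+j)` (each ratio `G(m+1)/G(m)`, `m ≥ n`, is at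
least the first one). [folklore] -/
theorem pow_mul_le_add (hpos : ∀ n, 0 < G n) (hmono : Monotone fun k => G (k + 2) / G (k + 1)) {n : ℕ}
    (hn : 1 ≤ n) : ∀ j : ℕ, (G (n - 1 + 2) / G (n - 1 + 1)) ^ j * G n ≤ G (n + j) := by
  intro j
  induction j with
  | zero => simp
  | succ j ih =>
    have hrec : G (n + (j + 1)) = G (n + j - 1 + 2) / G (n + j - 1 + 1) * G (n + j) := by
      rw [show n + (j + 1) = (n + j - 1) + 2 by omega, show n + j - 1 + 1 = n + j by omega]
      exact (div_mul_cancel₀ _ (hpos (n + j)).ne').symm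
    have hRle : G (n - 1 + 2) / G (n - 1 + 1) ≤ G (n + j - 1 + 2) / G (n + j - 1 + 1) := hmono (by omega)
    have hRpos : 0 < G (n - 1 + 2) / G (n - 1 + 1) := div_pos (hpos _) (hpos _)
    rw [hrec, pow_succ]
    calc (G (n - 1 + 2) / G (n - 1 + 1)) ^ j * (G (n - 1 + 2) / G (n - 1 + 1)) * G n
        = G (n - 1 + 2) / G (n - 1 + 1) * ((G (n - 1 + 2) / G (n - 1 + 1)) ^ j * G n) := by ring
      _ ≤ G (n + j - 1 + 2) / G (n + j - 1 + 1) * G (n + j) :=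
          mul_le_mul hRle ih (mul_nonneg (pow_nonneg hRpos.le _) (hpos _).le) (hRpos.le.trans hRle)

/-- `1 − κ^{1/n} ≤ −(log κ)/n` for `κ > 0`, `n ≥ 1` (`e^t ≥ 1 + t`). [folklore] -/
theorem one_sub_rpow_inv_le {κ : ℝ} (hκ : 0 < κ) {n : ℕ} (hn : 1 ≤ n) :
    1 - κ ^ ((n : ℝ)⁻¹) ≤ -Real.log κ / n := by
  have h := Real.add_one_le_exp (Real.log κ / n)
  rw [Real.rpow_def_of_pos hκ, show Real.log κ * (n : ℝ)⁻¹ = Real.log κ / n from rfl]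
  have : (0 : ℝ) < n := by exact_mod_cast hn
  rw [neg_div]
  linarith

/-- `e^{−2A} ≤ (1 − A/n)ⁿ` for `0 ≤ A`, `2A ≤ n`, `n ≥ 1` (`log(1 − x) ≥ −x/(1−x) ≥ −2x` on `[0, 1/2]`). [folklore] -/
theorem exp_neg_two_mul_le_pow {A : ℝ} (hA : 0 ≤ A) {n : ℕ} (hn : 1 ≤ n) (hAn : 2 * A ≤ n) :
    Real.exp (-2 * A) ≤ (1 - A / n) ^ n := by
  have hn0 : (0 : ℝ) < n := by exact_mod_cast hn
  set x : ℝ := A / n with hx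
  have hx0 : 0 ≤ x := div_nonneg hA hn0.le
  have hx2 : x ≤ 1 / 2 := by
    rw [hx, div_le_iff₀ hn0]; linarith
  have h1x : 0 < 1 - x := by linarith
  -- `-log(1-x) = log((1-x)⁻¹) ≤ (1-x)⁻¹ - 1 = x/(1-x) ≤ 2x`
  have hlog : -2 * x ≤ Real.log (1 - x) := by
    have h1 := Real.log_le_sub_one_of_pos (inv_pos.2 h1x)
    rw [Real.log_inv] at h1
    have h2 : (1 - x)⁻¹ - 1 ≤ 2 * x := by
      rw [show (1 - x)⁻¹ - 1 = x / (1 - x) by field_simp; ring]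
      rw [div_le_iff₀ h1x]
      nlinarith
    linarith
  have hpow : (1 - x) ^ n = Real.exp (n * Real.log (1 - x)) := by
    rw [Real.exp_nat_mul, Real.exp_log h1x]
  rw [hpow, Real.exp_le_exp]
  have hnx : (n : ℝ) * x = A := by rw [hx]; field_simp
  nlinarith [mul_le_mul_of_nonneg_left hlog hn0.le]

/-- **(⇒) Doubling gives the rate.** For a positive sequence with nondecreasing shifted ratios and `G(2) ≤ G(1)`:
`κ G(n) ≤ G(2n)` for all `n ≥ 1` implies `G(k) − G(k+1) ≤ (−2 log κ)·G(k)/k` for all `k ≥ 1`. [folklore] -/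
theorem rate_of_doubling (hpos : ∀ n, 0 < G n) (hmono : Monotone fun k => G (k + 2) / G (k + 1))
    (h21 : G 2 ≤ G 1) {κ : ℝ} (hκ : 0 < κ) (hD : ∀ n : ℕ, 1 ≤ n → κ * G n ≤ G (2 * n)) :
    ∀ k : ℕ, 1 ≤ k → G k - G (k + 1) ≤ (-2 * Real.log κ) * G k / k := by
  -- `κ ≤ 1` from `n = 1`: `κ G(1) ≤ G(2) ≤ G(1)`
  have hκ1 : κ ≤ 1 := by
    have h1 := hD 1 le_rfl
    have hg1 := hpos 1
    nlinarith
  have hlogκ : Real.log κ ≤ 0 := Real.log_nonpos hκ.le hκ1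
  intro k hk
  -- `n = ⌈k/2⌉`: `1 ≤ n`, `2n ≤ k+1`, `k ≤ 2n`
  set n : ℕ := (k + 1) / 2 with hn
  have hn1 : 1 ≤ n := by omega
  have hnk : 2 * n ≤ (k - 1) + 2 := by omega
  have hkn : k ≤ 2 * n := by omega
  have hn0 : (0 : ℝ) < n := by exact_mod_cast hn1
  have hk0 : (0 : ℝ) < k := by exact_mod_cast hk
  -- `κ ≤ ρ^n`, `ρ = G(k+1)/G(k)`
  set ρ : ℝ := G (k - 1 + 2) / G (k - 1 + 1) with hρ
  have hρ0 : 0 < ρ := div_pos (hpos _) (hpos _)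
  have hκρ : κ ≤ ρ ^ n := by
    have h1 := hD n hn1
    have h2 := add_le_pow_mul hpos hmono hnk n le_rfl
    rw [← two_mul] at h2
    exact le_of_mul_le_mul_right (h1.trans h2) (hpos n)
  -- `κ^{1/n} ≤ ρ`
  have hroot : κ ^ ((n : ℝ)⁻¹) ≤ ρ := by
    have h := Real.rpow_le_rpow hκ.le hκρ (inv_nonneg.2 hn0.le)
    rwa [Real.pow_rpow_inv_natCast hρ0.le (by omega : n ≠ 0)] at h
  -- `1 − ρ ≤ −log κ / n ≤ −2 log κ / k`
  have h1ρ : 1 - ρ ≤ -Real.log κ / n := (sub_le_sub_left hroot 1).trans (one_sub_rpow_inv_le hκ hn1)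
  have h1ρ' : 1 - ρ ≤ -2 * Real.log κ / k := by
    refine h1ρ.trans ?_
    rw [div_le_div_iff₀ hn0 hk0]
    have : (k : ℝ) ≤ 2 * n := by exact_mod_cast hkn
    nlinarith
  -- `G(k) − G(k+1) = G(k)(1 − ρ)`
  have hstep : G (k + 1) = ρ * G k := by
    rw [hρ, show k - 1 + 2 = k + 1 by omega, show k - 1 + 1 = k by omega]
    exact (div_mul_cancel₀ _ (hpos k).ne').symm
  have hgk := hpos k
  calc G k - G (k + 1) = (1 - ρ) * G k := by rw [hstep]; ring
    _ ≤ (-2 * Real.log κ / k) * G k := mul_le_mul_of_nonneg_right h1ρ' hgk.le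
    _ = (-2 * Real.log κ) * G k / k := by ring

/-- **(⇐) The rate gives doubling.** For a positive sequence with nondecreasing shifted ratios and `G(2) ≤ G(1)`:
`G(k) − G(k+1) ≤ A·G(k)/k` for all `k ≥ 1` implies `κ G(n) ≤ G(2n)` for all `n ≥ 1`, with
`κ = e^{−2A'} (G(2)/G(1))^{⌈2A'⌉}`, `A' = max A 1`. [folklore] -/
theorem doubling_of_rate (hpos : ∀ n, 0 < G n) (hmono : Monotone fun k => G (k + 2) / G (k + 1))
    (h21 : G 2 ≤ G 1) {A : ℝ} (hA : ∀ k : ℕ, 1 ≤ k → G k - G (k + 1) ≤ A * G k / k) :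
    ∃ κ : ℝ, 0 < κ ∧ ∀ n : ℕ, 1 ≤ n → κ * G n ≤ G (2 * n) := by
  set A' : ℝ := max A 1 with hA'
  have hA'1 : 1 ≤ A' := le_max_right _ _
  have hA'0 : 0 ≤ A' := zero_le_one.trans hA'1
  -- the ratio bound `1 − A'/k ≤ G(k+1)/G(k)` for `k ≥ 1`
  have hR : ∀ k : ℕ, 1 ≤ k → 1 - A' / k ≤ G (k - 1 + 2) / G (k - 1 + 1) := by
    intro k hk
    have hk0 : (0 : ℝ) < k := by exact_mod_cast hk
    have hgk := hpos k
    have h1 : G k - G (k + 1) ≤ A' * G k / k := by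
      refine (hA k hk).trans ?_
      rw [div_le_div_iff_of_pos_right hk0]
      exact mul_le_mul_of_nonneg_right (le_max_left _ _) hgk.le
    rw [show k - 1 + 2 = k + 1 by omega, show k - 1 + 1 = k by omega, le_div_iff₀ hgk]
    have h2 : A' * G k / k = A' / k * G k := by ring
    rw [h2] at h1
    nlinarith
  set N₀ : ℕ := ⌈2 * A'⌉₊ with hN₀
  set R0 : ℝ := G (0 + 2) / G (0 + 1) with hR0d
  set κ : ℝ := Real.exp (-2 * A') * R0 ^ N₀ with hκ
  have hR0 : 0 < R0 := div_pos (hpos _) (hpos _)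
  have hR01 : R0 ≤ 1 := (div_le_one (hpos _)).2 h21
  have hexp1 : Real.exp (-2 * A') ≤ 1 := Real.exp_le_one_iff.2 (by linarith)
  have hpow1 : R0 ^ N₀ ≤ 1 := pow_le_one₀ hR0.le hR01
  refine ⟨κ, by positivity, fun n hn => ?_⟩
  have hgn := hpos n
  have hlow : (G (n - 1 + 2) / G (n - 1 + 1)) ^ n * G n ≤ G (2 * n) := by
    have h := pow_mul_le_add hpos hmono hn n
    rwa [← two_mul] at h
  rcases le_or_gt N₀ n with hbig | hsmall
  · -- `n ≥ 2A'`: `G(2n) ≥ r^n G(n) ≥ (1 − A'/n)^n G(n) ≥ e^{−2A'} G(n) ≥ κ G(n)`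
    have hn0 : (0 : ℝ) < n := by exact_mod_cast hn
    have hAn : 2 * A' ≤ n := (Nat.le_ceil _).trans (by exact_mod_cast hbig)
    have hbase : 0 ≤ 1 - A' / n := by
      rw [sub_nonneg, div_le_one hn0]; linarith
    have h1 : (1 - A' / n) ^ n ≤ (G (n - 1 + 2) / G (n - 1 + 1)) ^ n := pow_le_pow_left₀ hbase (hR n hn) n
    have h2 : Real.exp (-2 * A') ≤ (1 - A' / n) ^ n := exp_neg_two_mul_le_pow hA'0 hn hAn
    calc κ * G n ≤ Real.exp (-2 * A') * G n := by
          have : Real.exp (-2 * A') * R0 ^ N₀ ≤ Real.exp (-2 * A') :=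
            mul_le_of_le_one_right (Real.exp_pos _).le hpow1
          exact mul_le_mul_of_nonneg_right this hgn.le
      _ ≤ (G (n - 1 + 2) / G (n - 1 + 1)) ^ n * G n := mul_le_mul_of_nonneg_right (h2.trans h1) hgn.le
      _ ≤ G (2 * n) := hlow
  · -- `n < N₀`: `G(2n) ≥ r^n G(n) ≥ R0^n G(n) ≥ R0^{N₀} G(n) ≥ κ G(n)`
    have hmn : R0 ≤ G (n - 1 + 2) / G (n - 1 + 1) := hmono (Nat.zero_le _)
    have h1 : R0 ^ n ≤ (G (n - 1 + 2) / G (n - 1 + 1)) ^ n := pow_le_pow_left₀ hR0.le hmn n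
    have h2 : R0 ^ N₀ ≤ R0 ^ n := pow_le_pow_of_le_one hR0.le hR01 hsmall.le
    calc κ * G n ≤ R0 ^ N₀ * G n := by
          have : Real.exp (-2 * A') * R0 ^ N₀ ≤ R0 ^ N₀ := mul_le_of_le_one_left (pow_nonneg hR0.le _) hexp1
          exact mul_le_mul_of_nonneg_right this hgn.le
      _ ≤ (G (n - 1 + 2) / G (n - 1 + 1)) ^ n * G n := mul_le_mul_of_nonneg_right (h2.trans h1) hgn.le
      _ ≤ G (2 * n) := hlow

/-- Doubling along the dyadic scales gives doubling at all scales (with `κ²`), for a nonincreasing positive sequence: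
`G(2n) ≥ G(2^{j+2}) ≥ κ² G(2^j) ≥ κ² G(n)` for `2^j ≤ n < 2^{j+1}`. [folklore] -/
theorem doubling_of_dyadic (hanti : Antitone G) {κ : ℝ} (hκ : 0 < κ)
    (hD : ∀ j : ℕ, κ * G (2 ^ j) ≤ G (2 ^ (j + 1))) :
    ∀ n : ℕ, 1 ≤ n → κ ^ 2 * G n ≤ G (2 * n) := by
  intro n hn
  set j : ℕ := Nat.log 2 n with hj
  have hjn : 2 ^ j ≤ n := Nat.pow_log_le_self 2 (by omega)
  have hnj : n < 2 ^ (j + 1) := Nat.lt_pow_succ_log_self one_lt_two n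
  have h1 : G n ≤ G (2 ^ j) := hanti hjn
  have h2 : G (2 ^ (j + 2)) ≤ G (2 * n) := hanti (by rw [pow_succ]; omega)
  calc κ ^ 2 * G n ≤ κ ^ 2 * G (2 ^ j) := mul_le_mul_of_nonneg_left h1 (by positivity)
    _ = κ * (κ * G (2 ^ j)) := by ring
    _ ≤ κ * G (2 ^ (j + 1)) := mul_le_mul_of_nonneg_left (hD j) hκ.le
    _ ≤ G (2 ^ (j + 1 + 1)) := hD (j + 1)
    _ ≤ G (2 * n) := h2

/-- Eventual doubling gives doubling at all scales: the finitely many small `n` are free because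
`G(2n) ≥ (G(2)/G(1))ⁿ G(n)`. [folklore] -/
theorem doubling_of_eventually (hpos : ∀ n, 0 < G n) (hmono : Monotone fun k => G (k + 2) / G (k + 1))
    (h21 : G 2 ≤ G 1) {κ : ℝ} (hκ : 0 < κ) {N : ℕ} (hD : ∀ n : ℕ, N ≤ n → κ * G n ≤ G (2 * n)) :
    ∃ κ' : ℝ, 0 < κ' ∧ ∀ n : ℕ, 1 ≤ n → κ' * G n ≤ G (2 * n) := by
  set R0 : ℝ := G (0 + 2) / G (0 + 1) with hR0d
  have hR0 : 0 < R0 := div_pos (hpos _) (hpos _)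
  have hR01 : R0 ≤ 1 := (div_le_one (hpos _)).2 h21
  refine ⟨min κ (R0 ^ N), lt_min hκ (by positivity), fun n hn => ?_⟩
  have hgn := hpos n
  rcases le_or_gt N n with hbig | hsmall
  · exact (mul_le_mul_of_nonneg_right (min_le_left _ _) hgn.le).trans (hD n hbig)
  · have hmn : R0 ≤ G (n - 1 + 2) / G (n - 1 + 1) := hmono (Nat.zero_le _)
    have h1 : R0 ^ n ≤ (G (n - 1 + 2) / G (n - 1 + 1)) ^ n := pow_le_pow_left₀ hR0.le hmn n
    have h2 : R0 ^ N ≤ R0 ^ n := pow_le_pow_of_le_one hR0.le hR01 hsmall.le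
    have hlow : (G (n - 1 + 2) / G (n - 1 + 1)) ^ n * G n ≤ G (2 * n) := by
      have h := pow_mul_le_add hpos hmono hn n
      rwa [← two_mul] at h
    calc min κ (R0 ^ N) * G n ≤ R0 ^ N * G n := mul_le_mul_of_nonneg_right (min_le_right _ _) hgn.le
      _ ≤ (G (n - 1 + 2) / G (n - 1 + 1)) ^ n * G n := mul_le_mul_of_nonneg_right (h2.trans h1) hgn.le
      _ ≤ G (2 * n) := hlow

end LogConvexSeq

/-! ## Part B. The critical axis two-point function of `ℤ³` -/

/-- `⟨σ₀σ_{n eᵢ}⟩_{β_c} > 0` on `ℤ³` along every axis (Simon–Lieb lower bound off the origin, `⟨σ₀σ₀⟩ = 1` at it).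
[cite: Simon1980, Thm. 1] -/
theorem criticalTwoPoint_axis_pos (i : Fin 3) (n : ℕ) : 0 < criticalTwoPoint 3 (Pi.single i (n : ℤ)) := by
  by_cases hx : (Pi.single i (n : ℤ) : Site 3) = 0
  · rw [hx, criticalTwoPoint_zero']; exact one_pos
  · obtain ⟨c, C, hc, hb⟩ := criticalTwoPoint_bounds_holds (d := 3) le_rfl
    exact lt_of_lt_of_le (mul_pos hc (Real.rpow_pos_of_pos (norm_pos_iff.2 hx) _)) (hb _ hx).1

/-- The critical axis function is nonincreasing on `ℕ` along every axis (`⟨σ₀σ_{eᵢ}⟩ ≤ ⟨σ₀σ₀⟩ = 1` and the tree's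
`criticalTwoPoint_axis_succ_le`). [cite: AizenmanDuminilCopinAnnals2021, arXiv:1912.07973 §5.5 (p. 19)] -/
theorem criticalTwoPoint_axis_antitone (i : Fin 3) : Antitone fun n : ℕ => criticalTwoPoint 3 (Pi.single i (n : ℤ)) := by
  refine antitone_nat_of_succ_le fun n => ?_
  cases n with
  | zero =>
    show criticalTwoPoint 3 (Pi.single i ((0 + 1 : ℕ) : ℤ)) ≤ criticalTwoPoint 3 (Pi.single i ((0 : ℕ) : ℤ))
    rw [show (Pi.single i ((0 : ℕ) : ℤ) : Site 3) = 0 by simp, criticalTwoPoint_zero']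
    exact criticalTwoPoint_le_one' _
  | succ k => exact criticalTwoPoint_axis_succ_le i k

/-- `g(2n)` in the cast form of item 6150. [folklore] -/
theorem criticalTwoPoint_two_mul (n : ℕ) :
    criticalTwoPoint 3 (Pi.single 0 (2 * (n : ℤ))) = criticalTwoPoint 3 (Pi.single 0 ((2 * n : ℕ) : ℤ)) := by
  push_cast
  rfl

/-- **Item 6150 ⟺ the log-free axial gradient bound of Aizenman–Duminil-Copin, Remark 5.10**:
`TwoPointDoubling ↔ ∃ A, ∀ k ≥ 1, ⟨σ₀σ_{ke₀}⟩_{β_c} − ⟨σ₀σ_{(k+1)e₀}⟩_{β_c} ≤ A·⟨σ₀σ_{ke₀}⟩_{β_c}/k` — the estimate whose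
`log k` version is their Prop. 5.9 and whose log-free version they single out as open and as exactly what controls the
drop of `S(ne₁)` between scales. [cite: AizenmanDuminilCopinAnnals2021, arXiv:1912.07973 Prop. 5.9 and Remark 5.10 (p. 20)] -/
theorem twoPointDoubling_iff_axisGradientRate :
    MirrorHoelderCompactness.TwoPointDoubling ↔
      ∃ A : ℝ, ∀ k : ℕ, 1 ≤ k →
        criticalTwoPoint 3 (Pi.single 0 (k : ℤ)) - criticalTwoPoint 3 (Pi.single 0 ((k + 1 : ℕ) : ℤ)) ≤
          A * criticalTwoPoint 3 (Pi.single 0 (k : ℤ)) / k := by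
  have hpos : ∀ n : ℕ, 0 < criticalTwoPoint 3 (Pi.single 0 (n : ℤ)) := criticalTwoPoint_axis_pos 0
  have hmono := criticalTwoPoint_axis_ratio_mono 0
  have h21 : criticalTwoPoint 3 (Pi.single 0 ((2 : ℕ) : ℤ)) ≤ criticalTwoPoint 3 (Pi.single 0 ((1 : ℕ) : ℤ)) :=
    criticalTwoPoint_axis_succ_le 0 0
  unfold MirrorHoelderCompactness.TwoPointDoubling
  simp only [criticalTwoPoint_two_mul]
  constructor
  · rintro ⟨κ, hκ, hD⟩
    exact ⟨-2 * Real.log κ,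
      LogConvexSeq.rate_of_doubling (G := fun n : ℕ => criticalTwoPoint 3 (Pi.single 0 (n : ℤ))) hpos hmono h21 hκ hD⟩
  · rintro ⟨A, hA⟩
    exact LogConvexSeq.doubling_of_rate (G := fun n : ℕ => criticalTwoPoint 3 (Pi.single 0 (n : ℤ))) hpos hmono h21 hA

/-- **Item 6150 ⟺ the RATE in axis ratio regularity**: `TwoPointDoubling ↔ ∃ A, ∀ k ≥ 1, k·(1 − g(k+1)/g(k)) ≤ A` — the
quantitative form of `criticalTwoPoint_axis_ratio_tendsto_one` (`r_k ↑ 1`) that its docstring records as the open part.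
[cite: AizenmanDuminilCopinAnnals2021, arXiv:1912.07973 Remark 5.10 (p. 20)] -/
theorem twoPointDoubling_iff_axisRatioRate :
    MirrorHoelderCompactness.TwoPointDoubling ↔
      ∃ A : ℝ, ∀ k : ℕ, 1 ≤ k →
        (k : ℝ) * (1 - criticalTwoPoint 3 (Pi.single 0 ((k + 1 : ℕ) : ℤ)) / criticalTwoPoint 3 (Pi.single 0 (k : ℤ))) ≤ A := by
  rw [twoPointDoubling_iff_axisGradientRate]
  refine exists_congr fun A => forall_congr' fun k => forall_congr' fun hk => ?_
  have hgk : 0 < criticalTwoPoint 3 (Pi.single 0 (k : ℤ)) := criticalTwoPoint_axis_pos 0 k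
  have hk0 : (0 : ℝ) < k := by exact_mod_cast hk
  rw [one_sub_div hgk.ne', mul_div_assoc', div_le_iff₀ hgk, le_div_iff₀ hk0]
  constructor <;> intro h <;> linarith

/-- **Item 6150 ⟺ doubling along the dyadic scales only**: `TwoPointDoubling ↔ ∃ κ > 0, ∀ j, κ g(2^j) ≤ g(2^{j+1})`.
[folklore] -/
theorem twoPointDoubling_iff_dyadic :
    MirrorHoelderCompactness.TwoPointDoubling ↔
      ∃ κ : ℝ, 0 < κ ∧ ∀ j : ℕ,
        κ * criticalTwoPoint 3 (Pi.single 0 ((2 ^ j : ℕ) : ℤ)) ≤ criticalTwoPoint 3 (Pi.single 0 ((2 ^ (j + 1) : ℕ) : ℤ)) := by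
  unfold MirrorHoelderCompactness.TwoPointDoubling
  simp only [criticalTwoPoint_two_mul]
  constructor
  · rintro ⟨κ, hκ, hD⟩
    refine ⟨κ, hκ, fun j => ?_⟩
    rw [pow_succ, mul_comm (2 ^ j) 2]
    exact hD (2 ^ j) Nat.one_le_two_pow
  · rintro ⟨κ, hκ, hD⟩
    exact ⟨κ ^ 2, by positivity,
      LogConvexSeq.doubling_of_dyadic (G := fun n : ℕ => criticalTwoPoint 3 (Pi.single 0 (n : ℤ)))
        (criticalTwoPoint_axis_antitone 0) hκ hD⟩

/-- **Item 6150 ⟺ eventual doubling** (`liminf_n g(2n)/g(n) > 0`; small `n` are free). [folklore] -/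
theorem twoPointDoubling_iff_eventually :
    MirrorHoelderCompactness.TwoPointDoubling ↔
      ∃ κ : ℝ, 0 < κ ∧ ∀ᶠ n : ℕ in atTop,
        κ * criticalTwoPoint 3 (Pi.single 0 (n : ℤ)) ≤ criticalTwoPoint 3 (Pi.single 0 (2 * (n : ℤ))) := by
  have hpos : ∀ n : ℕ, 0 < criticalTwoPoint 3 (Pi.single 0 (n : ℤ)) := criticalTwoPoint_axis_pos 0
  have hmono := criticalTwoPoint_axis_ratio_mono 0
  have h21 : criticalTwoPoint 3 (Pi.single 0 ((2 : ℕ) : ℤ)) ≤ criticalTwoPoint 3 (Pi.single 0 ((1 : ℕ) : ℤ)) :=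
    criticalTwoPoint_axis_succ_le 0 0
  unfold MirrorHoelderCompactness.TwoPointDoubling
  simp only [criticalTwoPoint_two_mul]
  constructor
  · rintro ⟨κ, hκ, hD⟩
    exact ⟨κ, hκ, (eventually_ge_atTop 1).mono fun n hn => hD n hn⟩
  · rintro ⟨κ, hκ, hD⟩
    obtain ⟨N, hN⟩ := eventually_atTop.1 hD
    exact LogConvexSeq.doubling_of_eventually (G := fun n : ℕ => criticalTwoPoint 3 (Pi.single 0 (n : ℤ)))
      hpos hmono h21 hκ hN

end Summit.CriticalPhenomena.Ising3DConformalLimit.Cruxes.ExistsScaleCovariantLimit.Funnel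

end
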